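import Summits.AtomisticToContinuum.Crystallization.Theorems.SquareWellLayerCakeGapTwelveToBarlowCombinatorialLayeringTransportSteps1
import Summits.AtomisticToContinuum.Crystallization.Theorems.SquareWellLayerCakeGapTwelveToBarlowCombinatorialLayeringTransportSteps2
import Summits.AtomisticToContinuum.Crystallization.Theorems.SquareWellLayerCakeGapTwelveToBarlowCombinatorialLayeringTransportSteps6
import Summits.AtomisticToContinuum.Crystallization.Theorems.SquareWellLayerCakeGapTwelveToBarlowCombinatorialLayeringTransportLower
import Summits.AtomisticToContinuum.Crystallization.Theorems.SquareWellLayerCakeGapTwelveToBarlowCombinatorialLayeringTransportVinv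
import Summits.AtomisticToContinuum.Crystallization.Theorems.SquareWellLayerCakeGapTwelveToBarlowCombinatorialLayeringTransportAttach1

/-!
# Combinatorial layering (B1a of `GapTwelveToBarlow`): transport port, part `Attach2`

Crux `SquareWellLayerCake.GapTwelveToBarlow` (stmt-AtomisticToContinuum-15807), line `Sketch`,
stub `stub_combinatorialLayering`, residual `(H_develop)`.  PORT of the tree file
`PalmUnimodularRigidityShellsToBarlowChartTransportAttach2.lean` (crux 9227) to GRADED COMBINATORIAL
charts, following the port rules recorded in `…CombinatorialLayeringTransportSteps1` (bundled
standing hypothesis `hch` on `S : ℕ → Set E3`, abstract bond relation `B`, memberships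
`x ∈ S (n + k)`, transfer as an input).  Statements and proofs are otherwise those of the source,
whose documentation follows.

# Line `develop-the-model-growth-descent` (crux `ShellsToBarlowChart`, stmt-AtomisticToContinuum-9227): swap symmetry and the attachment of transported caps (part 2/2)

Helper lemmas for `stub_transportSystem` (the geometric half of the line): frames `⟨x, t₁, t₂, U⟩`
read in the integer charts `IsZChart` of a good-shell configuration, their transports and the
coherence of the resulting development `frameAt`.  The only metric inputs are the chart transfer
lemma and `bond_nb_iff`; everything else is label combinatorics in `ℤ³` (pattern facts
`TransportPatterns*`).  All `[folklore]` (HalesDSP2012 §1.3 for the two kissing patterns).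
-/

noncomputable section

namespace Summit.AtomisticToContinuum.Crystallization.Theorems.SquareWellLayerCakeGapTwelveToBarlow

open Literature.Geometry.DiscreteGeometry Literature.MathematicalPhysics.StatisticalMechanics
open Summit.AtomisticToContinuum.Crystallization.Theorems.PalmUnimodularRigidityShellsToBarlowChart hiding
  IsZChart TransportSystem scales_tied sqNormInt_transfer bond_symm nb_mem zlab_spec zlab_nb
  bond_nb_iff pattern_cases transfer_nb_nb transfer_nb_centre transfer_nb_target
  sqNormInt_zlab_centre hcp_of_mirror_pair Istep_spec Jstep_spec IinvStep_spec JinvStep_spec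
  capWithAny_of_mem_cap IinvStep_Istep Istep_IinvStep JinvStep_Jstep Jstep_JinvStep polar_at_apex
  onesided_at_apex Vstep_spec nb_inj Istep_lower Jstep_lower IinvStep_lower JinvStep_lower
  polar_at_lower_apex onesided_at_lower_apex VinvStep_spec attach_I_even attach_I_odd
  attach_lower_I_pos attach_lower_I_neg attach_J_even attach_J_odd Vstep_Istep_pt Vstep_Istep_back
  Vstep_Istep_side Vstep_Jstep_pt Vstep_Istep_comm Vstep_Jstep_comm attach_lower_J_pos
  attach_lower_J_neg VinvStep_Istep_pt VinvStep_Jstep_pt VinvStep_Istep_back VinvStep_Istep_side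
  VinvStep_Istep_comm VinvStep_Jstep_comm Istep_Jstep_comm

variable {S : ℕ → Set (EuclideanSpace ℝ (Fin 3))}
  {B : EuclideanSpace ℝ (Fin 3) → EuclideanSpace ℝ (Fin 3) → Prop}
  {Pc : EuclideanSpace ℝ (Fin 3) → Finset (Fin 3 → ℤ)}
  {nb : EuclideanSpace ℝ (Fin 3) → (Fin 3 → ℤ) → EuclideanSpace ℝ (Fin 3)}

variable
  (hch : (∀ n : ℕ, ∀ z ∈ S n, (Pc z = fcc3Int ∨ Pc z = hcpInt) ∧
      Set.BijOn (nb z) (↑(Pc z) : Set (Fin 3 → ℤ)) {y | B z y} ∧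
      ∀ t ∈ Pc z, ∀ t' ∈ Pc z, (B (nb z t) (nb z t') ↔ sqNormInt (t - t') = 18)) ∧
    (∀ n : ℕ, ∀ z ∈ S (n + 1), ∀ y, B z y → y ∈ S n) ∧
    (∀ n m : ℕ, ∀ x ∈ S n, ∀ y ∈ S m, B x y →
      ∀ (z z' : EuclideanSpace ℝ (Fin 3)) (t t' u u' : Fin 3 → ℤ),
        (t = 0 ∧ z = x ∨ t ∈ Pc x ∧ z = nb x t) → (t' = 0 ∧ z' = x ∨ t' ∈ Pc x ∧ z' = nb x t') →
        (u = 0 ∧ z = y ∨ u ∈ Pc y ∧ z = nb y u) → (u' = 0 ∧ z' = y ∨ u' ∈ Pc y ∧ z' = nb y u') →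
        sqNormInt (u - u') = sqNormInt (t - t')) ∧
    (∀ x y, B x y → B y x))

include hch


/-- **Lower attachment across I, letter below `+1`**: the letter read below is preserved by the
I-step, and the lower apex site of `Ix` is the neighbour of `x` labelled `d + t₁` (`d` the lower
apex of `x`): in the model, `(k−1, i+1, j)` is a lower neighbour of `(k, i, j)`. [folklore] -/
theorem attach_lower_I_pos {n : ℕ} {x : (EuclideanSpace ℝ (Fin 3))} (hx : x ∈ S (n + 1)) {t₁ t₂ : Fin 3 → ℤ} {U : Finset (Fin 3 → ℤ)} (hU : IsFrame (Pc x) t₁ t₂ U) (hlp : lowerParity t₁ t₂ (lowerCap (Pc x) t₁ t₂ U) = 1) (hreg : Pc (nb x t₁) = fcc3Int ∨ Pc x = hcpInt ∨ (-zlab Pc nb (nb x t₁) x ∈ Pc (nb x t₁) ∧ -zlab Pc nb (nb x t₁) (nb x t₂) ∈ Pc (nb x t₁))) : lowerParity (Istep Pc nb ⟨x, t₁, t₂, U⟩).t₁ (Istep Pc nb ⟨x, t₁, t₂, U⟩).t₂ (lowerCap (Pc (nb x t₁)) (Istep Pc nb ⟨x, t₁, t₂, U⟩).t₁ (Istep Pc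 nb ⟨x, t₁, t₂, U⟩).t₂ (Istep Pc nb ⟨x, t₁, t₂, U⟩).U) = 1 ∧ nb (nb x t₁) (apexOf (Istep Pc nb ⟨x, t₁, t₂, U⟩).t₁ (Istep Pc nb ⟨x, t₁, t₂, U⟩).t₂ (lowerCap (Pc (nb x t₁)) (Istep Pc nb ⟨x, t₁, t₂, U⟩).t₁ (Istep Pc nb ⟨x, t₁, t₂, U⟩).t₂ (Istep Pc nb ⟨x, t₁, t₂, U⟩).U)) = nb x (apexOf t₁ t₂ (lowerCap (Pc x) t₁ t₂ U) + t₁) ∧ zlab Pc nb (nb x t₁) (nb x (apexOf t₁ t₂ (lowerCap (Pc x) t₁ t₂ U) + t₁)) = apexOf (Istep Pc nb ⟨x, t₁, t₂, U⟩).t₁ (Istep Pc nb ⟨x, t₁, t₂, U⟩).t₂ (lowerCap (Pc (nb x t₁)) (Istep Pc nb ⟨x, t₁, t₂, U⟩).t₁ (Istep Pc nb ⟨x, t₁, t₂, U⟩).t₂ (Istep Pc nb ⟨x, t₁, t₂, U⟩).U) := by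
  obtain ⟨ℓ, -, -, hfiltL, hbz, Dlw, hlamL⟩ := Istep_lower hch hx hU hreg
  obtain ⟨hyS, hbxy, hwP, hwx, hvP, hvnb, -, -, -, -, -, hframe, -, -⟩ := Istep_spec hch hx hU hreg
  have hPx := pattern_cases hch hx
  have hPy := pattern_cases hch hyS
  obtain ⟨h12, hhex, -, -, -⟩ := id hU
  have ht₁ : t₁ ∈ Pc x := hhex (mem_hexLabels_iff.2 (Or.inl rfl))
  have ht₂ : t₂ ∈ Pc x := hhex (mem_hexLabels_iff.2 (Or.inr (Or.inl rfl)))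
  obtain ⟨hdL, hdP, hdhex, hd1, hd2, hLeq⟩ := pos_form_of_lowerParity hPx hU hlp
  set d := apexOf t₁ t₂ (lowerCap (Pc x) t₁ t₂ U) with hd_def
  have hℓ : ℓ = d + t₁ := by
    have h1 := (filter_oddCap (Pc x) hPx t₁ ht₁ t₂ ht₂ d hdP h12 hhex hdhex hd1 hd2).1
    rw [← hLeq, hfiltL] at h1
    exact Finset.singleton_injective h1
  rw [hℓ] at hbz Dlw hlamL
  have hlam := zlab_spec hch hyS (nb_mem hch hx hd1).1 hbz
  -- `D(lam, v) = 36` by transfer (`v` = label of `nb x t₂`)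
  have hbJ : B (nb x t₁) (nb x t₂) :=
    (bond_nb_iff hch hx ht₁ ht₂).2 h12
  have Dlv : sqNormInt (zlab Pc nb (nb x t₁) (nb x (d + t₁)) - zlab Pc nb (nb x t₁) (nb x t₂)) = 36 := by
    rw [transfer_nb_nb hch hx hyS hbxy hd1 ht₂ hbz hbJ]
    exact (dist_oddCap_ca (Pc x) hPx t₁ ht₁ t₂ ht₂ d hdP h12 hhex hdhex hd1 hd2).2.1
  -- the new frame and its lower cap
  set a' := (Istep Pc nb ⟨x, t₁, t₂, U⟩).t₁ with ha'
  set b' := (Istep Pc nb ⟨x, t₁, t₂, U⟩).t₂ with hb'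
  set U' := (Istep Pc nb ⟨x, t₁, t₂, U⟩).U with hU'
  obtain ⟨h12', hhex', -, -, -⟩ := id hframe
  have ha'P : a' ∈ Pc (nb x t₁) := hhex' (mem_hexLabels_iff.2 (Or.inl rfl))
  have hb'P : b' ∈ Pc (nb x t₁) := hhex' (mem_hexLabels_iff.2 (Or.inr (Or.inl rfl)))
  have hva : zlab Pc nb (nb x t₁) (nb x t₂) = b' - a' := by
    show zlab Pc nb (nb x t₁) (nb x t₂) =
      (zlab Pc nb (nb x t₁) (nb x t₂) - zlab Pc nb (nb x t₁) x) - -zlab Pc nb (nb x t₁) x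
    abel
  have Dla : sqNormInt (zlab Pc nb (nb x t₁) (nb x (d + t₁)) + a') = 18 := by
    show sqNormInt (zlab Pc nb (nb x t₁) (nb x (d + t₁)) + -zlab Pc nb (nb x t₁) x) = 18
    rw [← sub_eq_add_neg]; exact Dlw
  rw [hva] at Dlv
  obtain ⟨d', hd'L, hd'P, hd'hex, hcase⟩ := lowerCap_cases hPy hframe
  rcases hcase with ⟨hLeq', hlp', hd1', hd2'⟩ | ⟨hLeq', hlp', hd1', hd2'⟩
  · -- letter `+1` again: `lam = d'` is the lower apex of `Ix`
    have hlam' : zlab Pc nb (nb x t₁) (nb x (d + t₁)) = d' := by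
      have h1 := (filter_oddCap (Pc (nb x t₁)) hPy a' ha'P b' hb'P d' hd'P h12' hhex' hd'hex hd1' hd2').2.2.1
      rw [← hLeq'] at h1
      have hmem : zlab Pc nb (nb x t₁) (nb x (d + t₁)) ∈
          (lowerCap (Pc (nb x t₁)) a' b' U').filter (fun e => sqNormInt (e + a') = 18) :=
        Finset.mem_filter.2 ⟨hlamL, Dla⟩
      rw [h1] at hmem
      exact Finset.mem_singleton.1 hmem
    have hapex' : apexOf a' b' (lowerCap (Pc (nb x t₁)) a' b' U') = d' :=
      apexOf_eq_of_form hPy (isFrame_lowerCap hPy hframe) hd'L (Or.inr hLeq')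
    rw [hapex']
    exact ⟨hlp', by rw [← hlam']; exact hlam.2, hlam'⟩
  · -- letter `−1` is impossible: `lam = d' − a'` would touch `v = b' − a'`
    exfalso
    have hlam' : zlab Pc nb (nb x t₁) (nb x (d + t₁)) = d' - a' := by
      have h1 := (filter_evenCap (Pc (nb x t₁)) hPy a' ha'P b' hb'P d' hd'P h12' hhex' hd'hex hd1' hd2').2.2.1
      rw [← hLeq'] at h1
      have hmem : zlab Pc nb (nb x t₁) (nb x (d + t₁)) ∈
          (lowerCap (Pc (nb x t₁)) a' b' U').filter (fun e => sqNormInt (e + a') = 18) :=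
        Finset.mem_filter.2 ⟨hlamL, Dla⟩
      rw [h1] at hmem
      exact Finset.mem_singleton.1 hmem
    rw [hlam', show d' - a' - (b' - a') = d' - b' by abel] at Dlv
    have h18 := (dist_evenCap_c (Pc (nb x t₁)) hPy a' ha'P b' hb'P d' hd'P h12' hhex' hd'hex hd1' hd2').2.1
    rw [Dlv] at h18
    norm_num at h18

/-- **Lower attachment across I, letter below `−1`**: the letter read below is preserved by the
I-step, and the lower apex site `nb x d` of `x` is the neighbour of `Ix` labelled `d₊ − t₁₊`:
in the model, `(k−1, i, j)` is the lower neighbour of `(k, i+1, j)` with offset `(1, 0)`.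
[folklore] -/
theorem attach_lower_I_neg {n : ℕ} {x : (EuclideanSpace ℝ (Fin 3))}
    (hx : x ∈ S (n + 1)) {t₁ t₂ : Fin 3 → ℤ} {U : Finset (Fin 3 → ℤ)} (hU : IsFrame (Pc x) t₁ t₂ U)
    (hlp : lowerParity t₁ t₂ (lowerCap (Pc x) t₁ t₂ U) = -1)
    (hreg : Pc (nb x t₁) = fcc3Int ∨ Pc x = hcpInt ∨
      (-zlab Pc nb (nb x t₁) x ∈ Pc (nb x t₁) ∧ -zlab Pc nb (nb x t₁) (nb x t₂) ∈ Pc (nb x t₁))) :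
    lowerParity (Istep Pc nb ⟨x, t₁, t₂, U⟩).t₁ (Istep Pc nb ⟨x, t₁, t₂, U⟩).t₂
        (lowerCap (Pc (nb x t₁)) (Istep Pc nb ⟨x, t₁, t₂, U⟩).t₁ (Istep Pc nb ⟨x, t₁, t₂, U⟩).t₂
          (Istep Pc nb ⟨x, t₁, t₂, U⟩).U) = -1 ∧
    nb (nb x t₁) (apexOf (Istep Pc nb ⟨x, t₁, t₂, U⟩).t₁ (Istep Pc nb ⟨x, t₁, t₂, U⟩).t₂
        (lowerCap (Pc (nb x t₁)) (Istep Pc nb ⟨x, t₁, t₂, U⟩).t₁ (Istep Pc nb ⟨x, t₁, t₂, U⟩).t₂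
          (Istep Pc nb ⟨x, t₁, t₂, U⟩).U) - (Istep Pc nb ⟨x, t₁, t₂, U⟩).t₁) =
      nb x (apexOf t₁ t₂ (lowerCap (Pc x) t₁ t₂ U)) ∧
    zlab Pc nb (nb x t₁) (nb x (apexOf t₁ t₂ (lowerCap (Pc x) t₁ t₂ U))) =
      apexOf (Istep Pc nb ⟨x, t₁, t₂, U⟩).t₁ (Istep Pc nb ⟨x, t₁, t₂, U⟩).t₂
        (lowerCap (Pc (nb x t₁)) (Istep Pc nb ⟨x, t₁, t₂, U⟩).t₁ (Istep Pc nb ⟨x, t₁, t₂, U⟩).t₂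
          (Istep Pc nb ⟨x, t₁, t₂, U⟩).U) - (Istep Pc nb ⟨x, t₁, t₂, U⟩).t₁ := by
  obtain ⟨ℓ, -, -, hfiltL, hbz, Dlw, hlamL⟩ := Istep_lower hch hx hU hreg
  obtain ⟨hyS, hbxy, hwP, hwx, hvP, hvnb, -, -, -, -, -, hframe, -, -⟩ := Istep_spec hch hx hU hreg
  have hPx := pattern_cases hch hx
  have hPy := pattern_cases hch hyS
  obtain ⟨h12, hhex, -, -, -⟩ := id hU
  have ht₁ : t₁ ∈ Pc x := hhex (mem_hexLabels_iff.2 (Or.inl rfl))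
  have ht₂ : t₂ ∈ Pc x := hhex (mem_hexLabels_iff.2 (Or.inr (Or.inl rfl)))
  obtain ⟨hdL, hdP, hdhex, hd1, hd2, hLeq⟩ := neg_form_of_lowerParity hPx hU hlp
  set d := apexOf t₁ t₂ (lowerCap (Pc x) t₁ t₂ U) with hd_def
  have hℓ : ℓ = d := by
    have h1 := (filter_evenCap (Pc x) hPx t₁ ht₁ t₂ ht₂ d hdP h12 hhex hdhex hd1 hd2).1
    rw [← hLeq, hfiltL] at h1
    exact Finset.singleton_injective h1
  rw [hℓ] at hbz Dlw hlamL
  have hlam := zlab_spec hch hyS (nb_mem hch hx hdP).1 hbz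
  have hbJ : B (nb x t₁) (nb x t₂) :=
    (bond_nb_iff hch hx ht₁ ht₂).2 h12
  have Dlv : sqNormInt (zlab Pc nb (nb x t₁) (nb x d) - zlab Pc nb (nb x t₁) (nb x t₂)) = 18 := by
    rw [transfer_nb_nb hch hx hyS hbxy hdP ht₂ hbz hbJ]
    exact (dist_evenCap_c (Pc x) hPx t₁ ht₁ t₂ ht₂ d hdP h12 hhex hdhex hd1 hd2).2.1
  set a' := (Istep Pc nb ⟨x, t₁, t₂, U⟩).t₁ with ha'
  set b' := (Istep Pc nb ⟨x, t₁, t₂, U⟩).t₂ with hb'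
  set U' := (Istep Pc nb ⟨x, t₁, t₂, U⟩).U with hU'
  obtain ⟨h12', hhex', -, -, -⟩ := id hframe
  have ha'P : a' ∈ Pc (nb x t₁) := hhex' (mem_hexLabels_iff.2 (Or.inl rfl))
  have hb'P : b' ∈ Pc (nb x t₁) := hhex' (mem_hexLabels_iff.2 (Or.inr (Or.inl rfl)))
  have hva : zlab Pc nb (nb x t₁) (nb x t₂) = b' - a' := by
    show zlab Pc nb (nb x t₁) (nb x t₂) =
      (zlab Pc nb (nb x t₁) (nb x t₂) - zlab Pc nb (nb x t₁) x) - -zlab Pc nb (nb x t₁) x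
    abel
  have Dla : sqNormInt (zlab Pc nb (nb x t₁) (nb x d) + a') = 18 := by
    show sqNormInt (zlab Pc nb (nb x t₁) (nb x d) + -zlab Pc nb (nb x t₁) x) = 18
    rw [← sub_eq_add_neg]; exact Dlw
  rw [hva] at Dlv
  obtain ⟨d', hd'L, hd'P, hd'hex, hcase⟩ := lowerCap_cases hPy hframe
  rcases hcase with ⟨hLeq', hlp', hd1', hd2'⟩ | ⟨hLeq', hlp', hd1', hd2'⟩
  · -- letter `+1` is impossible: `lam = d'` is at `36` from `b' − a'`
    exfalso
    have hlam' : zlab Pc nb (nb x t₁) (nb x d) = d' := by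
      have h1 := (filter_oddCap (Pc (nb x t₁)) hPy a' ha'P b' hb'P d' hd'P h12' hhex' hd'hex hd1' hd2').2.2.1
      rw [← hLeq'] at h1
      have hmem : zlab Pc nb (nb x t₁) (nb x d) ∈
          (lowerCap (Pc (nb x t₁)) a' b' U').filter (fun e => sqNormInt (e + a') = 18) :=
        Finset.mem_filter.2 ⟨hlamL, Dla⟩
      rw [h1] at hmem
      exact Finset.mem_singleton.1 hmem
    rw [hlam'] at Dlv
    have h36 := (dist_oddCap_c (Pc (nb x t₁)) hPy a' ha'P b' hb'P d' hd'P h12' hhex' hd'hex hd1' hd2').2.2.1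
    rw [Dlv] at h36
    norm_num at h36
  · have hlam' : zlab Pc nb (nb x t₁) (nb x d) = d' - a' := by
      have h1 := (filter_evenCap (Pc (nb x t₁)) hPy a' ha'P b' hb'P d' hd'P h12' hhex' hd'hex hd1' hd2').2.2.1
      rw [← hLeq'] at h1
      have hmem : zlab Pc nb (nb x t₁) (nb x d) ∈
          (lowerCap (Pc (nb x t₁)) a' b' U').filter (fun e => sqNormInt (e + a') = 18) :=
        Finset.mem_filter.2 ⟨hlamL, Dla⟩
      rw [h1] at hmem
      exact Finset.mem_singleton.1 hmem
    have hapex' : apexOf a' b' (lowerCap (Pc (nb x t₁)) a' b' U') = d' :=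
      apexOf_eq_of_form hPy (isFrame_lowerCap hPy hframe) hd'L (Or.inl hLeq')
    rw [hapex']
    exact ⟨hlp', by rw [← hlam']; exact hlam.2, hlam'⟩

/-- **Upper attachment across J, even layer** (from the I-version by the swap symmetry).
[folklore] -/
theorem attach_J_even {n : ℕ} {x : (EuclideanSpace ℝ (Fin 3))}
    (hx : x ∈ S (n + 1)) {t₁ t₂ : Fin 3 → ℤ} {U : Finset (Fin 3 → ℤ)} (hU : IsFrame (Pc x) t₁ t₂ U)
    (hpar : frameParity t₁ t₂ U = 1)
    (hreg : Pc (nb x t₂) = fcc3Int ∨ Pc x = hcpInt ∨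
      (-zlab Pc nb (nb x t₂) x ∈ Pc (nb x t₂) ∧ -zlab Pc nb (nb x t₂) (nb x t₁) ∈ Pc (nb x t₂))) :
    nb (nb x t₂) (apexOf (Jstep Pc nb ⟨x, t₁, t₂, U⟩).t₁ (Jstep Pc nb ⟨x, t₁, t₂, U⟩).t₂
        (Jstep Pc nb ⟨x, t₁, t₂, U⟩).U - (Jstep Pc nb ⟨x, t₁, t₂, U⟩).t₂) = nb x (apexOf t₁ t₂ U) ∧
    zlab Pc nb (nb x t₂) (nb x (apexOf t₁ t₂ U)) =
      apexOf (Jstep Pc nb ⟨x, t₁, t₂, U⟩).t₁ (Jstep Pc nb ⟨x, t₁, t₂, U⟩).t₂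
        (Jstep Pc nb ⟨x, t₁, t₂, U⟩).U - (Jstep Pc nb ⟨x, t₁, t₂, U⟩).t₂ := by
  have hPx := pattern_cases hch hx
  have hU' : IsFrame (Pc x) t₂ t₁ U := isFrame_swap hU
  have hpar' : frameParity t₂ t₁ U = 1 := by rw [frameParity_swap]; exact hpar
  obtain ⟨h1, h2⟩ := attach_I_even hch hx hU' hpar' hreg
  obtain ⟨-, -, -, -, -, -, -, -, -, -, -, hframe', -⟩ := Istep_spec hch hx hU' hreg
  have hPy := pattern_cases hch (nb_mem hch hx (hU.2.1 (mem_hexLabels_iff.2 (Or.inr (Or.inl rfl))))).1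
  have ha : apexOf (Istep Pc nb ⟨x, t₂, t₁, U⟩).t₂ (Istep Pc nb ⟨x, t₂, t₁, U⟩).t₁
      (Istep Pc nb ⟨x, t₂, t₁, U⟩).U = apexOf (Istep Pc nb ⟨x, t₂, t₁, U⟩).t₁
      (Istep Pc nb ⟨x, t₂, t₁, U⟩).t₂ (Istep Pc nb ⟨x, t₂, t₁, U⟩).U := apexOf_swap hPy hframe'
  rw [apexOf_swap hPx hU] at h1 h2
  rw [Jstep_swap]
  exact ⟨by rw [ha]; exact h1, by rw [ha]; exact h2⟩

/-- **Upper attachment across J, odd layer** (from the I-version by the swap symmetry).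
[folklore] -/
theorem attach_J_odd {n : ℕ} {x : (EuclideanSpace ℝ (Fin 3))}
    (hx : x ∈ S (n + 1)) {t₁ t₂ : Fin 3 → ℤ} {U : Finset (Fin 3 → ℤ)} (hU : IsFrame (Pc x) t₁ t₂ U)
    (hpar : frameParity t₁ t₂ U = -1)
    (hreg : Pc (nb x t₂) = fcc3Int ∨ Pc x = hcpInt ∨
      (-zlab Pc nb (nb x t₂) x ∈ Pc (nb x t₂) ∧ -zlab Pc nb (nb x t₂) (nb x t₁) ∈ Pc (nb x t₂))) :
    nb (nb x t₂) (apexOf (Jstep Pc nb ⟨x, t₁, t₂, U⟩).t₁ (Jstep Pc nb ⟨x, t₁, t₂, U⟩).t₂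
        (Jstep Pc nb ⟨x, t₁, t₂, U⟩).U) = nb x (apexOf t₁ t₂ U + t₂) ∧
    zlab Pc nb (nb x t₂) (nb x (apexOf t₁ t₂ U + t₂)) =
      apexOf (Jstep Pc nb ⟨x, t₁, t₂, U⟩).t₁ (Jstep Pc nb ⟨x, t₁, t₂, U⟩).t₂
        (Jstep Pc nb ⟨x, t₁, t₂, U⟩).U := by
  have hPx := pattern_cases hch hx
  have hU' : IsFrame (Pc x) t₂ t₁ U := isFrame_swap hU
  have hpar' : frameParity t₂ t₁ U = -1 := by rw [frameParity_swap]; exact hpar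
  obtain ⟨h1, h2⟩ := attach_I_odd hch hx hU' hpar' hreg
  obtain ⟨-, -, -, -, -, -, -, -, -, -, -, hframe', -⟩ := Istep_spec hch hx hU' hreg
  have hPy := pattern_cases hch (nb_mem hch hx (hU.2.1 (mem_hexLabels_iff.2 (Or.inr (Or.inl rfl))))).1
  have ha : apexOf (Istep Pc nb ⟨x, t₂, t₁, U⟩).t₂ (Istep Pc nb ⟨x, t₂, t₁, U⟩).t₁
      (Istep Pc nb ⟨x, t₂, t₁, U⟩).U = apexOf (Istep Pc nb ⟨x, t₂, t₁, U⟩).t₁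
      (Istep Pc nb ⟨x, t₂, t₁, U⟩).t₂ (Istep Pc nb ⟨x, t₂, t₁, U⟩).U := apexOf_swap hPy hframe'
  rw [apexOf_swap hPx hU] at h1 h2
  rw [Jstep_swap]
  exact ⟨by rw [ha]; exact h1, by rw [ha]; exact h2⟩

omit hch in
/-! ## Registered anchor (closed form) -/

omit hch in
/-- **Closed form of `attach_J_odd`** (the registered anchor of this file): the section data
`S, B, Pc, nb` and the standing hypothesis written out (two hypotheses regrouped). [folklore] -/
theorem attach_J_odd_graded :
    ∀ {S : ℕ → Set (EuclideanSpace ℝ (Fin 3))} {B : EuclideanSpace ℝ (Fin 3) → EuclideanSpace ℝ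
    (Fin 3) → Prop} {Pc : EuclideanSpace ℝ (Fin 3) → Finset (Fin 3 → ℤ)} {nb : EuclideanSpace ℝ
    (Fin 3) → (Fin 3 → ℤ) → EuclideanSpace ℝ (Fin 3)}, ((∀ n : ℕ, ∀ z ∈ S n, (Pc z =
    Summit.AtomisticToContinuum.Crystallization.Theorems.PalmUnimodularRigidityShellsToBarlowChart.fcc3Int
    ∨ Pc z = Literature.Geometry.DiscreteGeometry.hcpInt) ∧ Set.BijOn (nb z) (↑(Pc z) : Set (Fin
    3 → ℤ)) {y | B z y} ∧ ∀ t ∈ Pc z, ∀ t' ∈ Pc z, (B (nb z t) (nb z t') ↔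
    Literature.Geometry.DiscreteGeometry.sqNormInt (t - t') = 18)) ∧ (∀ n : ℕ, ∀ z ∈ S (n + 1),
    ∀ y, B z y → y ∈ S n) ∧ (∀ n m : ℕ, ∀ x ∈ S n, ∀ y ∈ S m, B x y → ∀ (z z' : EuclideanSpace ℝ
    (Fin 3)) (t t' u u' : Fin 3 → ℤ), (t = 0 ∧ z = x ∨ t ∈ Pc x ∧ z = nb x t) → (t' = 0 ∧ z' = x
    ∨ t' ∈ Pc x ∧ z' = nb x t') → (u = 0 ∧ z = y ∨ u ∈ Pc y ∧ z = nb y u) → (u' = 0 ∧ z' = y ∨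
    u' ∈ Pc y ∧ z' = nb y u') → Literature.Geometry.DiscreteGeometry.sqNormInt (u - u') =
    Literature.Geometry.DiscreteGeometry.sqNormInt (t - t')) ∧ (∀ x y, B x y → B y x)) → ∀ {n :
    ℕ} {x : (EuclideanSpace ℝ (Fin 3))} {t₁ t₂ : Fin 3 → ℤ} {U : Finset (Fin 3 → ℤ)},
    Summit.AtomisticToContinuum.Crystallization.Theorems.PalmUnimodularRigidityShellsToBarlowChart.IsFrame
    (Pc x) t₁ t₂ U → x ∈ S (n + 1) →
    Summit.AtomisticToContinuum.Crystallization.Theorems.PalmUnimodularRigidityShellsToBarlowChart.frameParity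
    t₁ t₂ U = -1 → Pc (nb x t₂) =
    Summit.AtomisticToContinuum.Crystallization.Theorems.PalmUnimodularRigidityShellsToBarlowChart.fcc3Int
    ∨ Pc x = Literature.Geometry.DiscreteGeometry.hcpInt ∨
    (-Summit.AtomisticToContinuum.Crystallization.Theorems.PalmUnimodularRigidityShellsToBarlowChart.zlab
    Pc nb (nb x t₂) x ∈ Pc (nb x t₂) ∧
    -Summit.AtomisticToContinuum.Crystallization.Theorems.PalmUnimodularRigidityShellsToBarlowChart.zlab
    Pc nb (nb x t₂) (nb x t₁) ∈ Pc (nb x t₂)) → nb (nb x t₂)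
    (Summit.AtomisticToContinuum.Crystallization.Theorems.PalmUnimodularRigidityShellsToBarlowChart.apexOf
    (Summit.AtomisticToContinuum.Crystallization.Theorems.PalmUnimodularRigidityShellsToBarlowChart.Jstep
    Pc nb ⟨x, t₁, t₂, U⟩).t₁
    (Summit.AtomisticToContinuum.Crystallization.Theorems.PalmUnimodularRigidityShellsToBarlowChart.Jstep
    Pc nb ⟨x, t₁, t₂, U⟩).t₂
    (Summit.AtomisticToContinuum.Crystallization.Theorems.PalmUnimodularRigidityShellsToBarlowChart.Jstep
    Pc nb ⟨x, t₁, t₂, U⟩).U) = nb x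
    (Summit.AtomisticToContinuum.Crystallization.Theorems.PalmUnimodularRigidityShellsToBarlowChart.apexOf
    t₁ t₂ U + t₂) ∧
    Summit.AtomisticToContinuum.Crystallization.Theorems.PalmUnimodularRigidityShellsToBarlowChart.zlab
    Pc nb (nb x t₂) (nb x
    (Summit.AtomisticToContinuum.Crystallization.Theorems.PalmUnimodularRigidityShellsToBarlowChart.apexOf
    t₁ t₂ U + t₂)) =
    Summit.AtomisticToContinuum.Crystallization.Theorems.PalmUnimodularRigidityShellsToBarlowChart.apexOf
    (Summit.AtomisticToContinuum.Crystallization.Theorems.PalmUnimodularRigidityShellsToBarlowChart.Jstep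
    Pc nb ⟨x, t₁, t₂, U⟩).t₁
    (Summit.AtomisticToContinuum.Crystallization.Theorems.PalmUnimodularRigidityShellsToBarlowChart.Jstep
    Pc nb ⟨x, t₁, t₂, U⟩).t₂
    (Summit.AtomisticToContinuum.Crystallization.Theorems.PalmUnimodularRigidityShellsToBarlowChart.Jstep
    Pc nb ⟨x, t₁, t₂, U⟩).U := by
  intro S B Pc nb hch n x t₁ t₂ U hU hx hpar hreg
  exact attach_J_odd hch hx hU hpar hreg

end Summit.AtomisticToContinuum.Crystallization.Theorems.SquareWellLayerCakeGapTwelveToBarlow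

end
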